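/-
Copyright (c) 2026. All rights reserved.
Released under Apache 2.0 license as described in the file LICENSE.
Authors: HodgeCM publication cell (pub-hodgecm), GR lane, seat GR-2 (`pub-hodgecm-own-hyp34`).
-/
import Literature.NumberTheory.Weil1964.ArchFollandUnitaryPlaces
import Literature.NumberTheory.Weil1964.ArchFollandFrameTwist
import Literature.NumberTheory.Weil1964.ArchActQuadraticComplexPlaces
import Literature.NumberTheory.Weil1964.ArchComplexPlaceRealification
import HarnessLib

/-!
# The archimedean action of `U(J)(𝔸_F) ⊂ Sp(𝕎_𝔸)` in the general (real + complex places) Folland frame, slice by slice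

Topic `NumberTheory/Weil1964`; namespace `Literature.NumberTheory.Weil1964`.  KERNEL ONLY: one transparent abbreviation
(`cxTwist`) and proved theorems; no `def … : Prop` record, no axiom, no proof hole.

The general-`F` twin of `ArchFollandUnitaryPlaces` §1 (which is written for `F` totally real).  For a DIAGONAL
`F`-rational hermitian form `J = diag(t₀) ⊗ 1` over a quadratic extension `E/F`, embedded by restriction of scalars
`ι_𝔸 = adelicToSymplectic`, read in the TWISTED general frame `e_T = scaledFrameGenT (cxTwist wOf) D 1`
(`ArchFollandFrameTwist`; real scalings `D` adapted place by place as in the CM dictionary, complex scalings `1`, complex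
coordinates read through `placeTwist v w(v)`):

* §1 at a REAL place `v` of `F` under a complex place `w(v)` of `E`: the real `v`-slices of
  `Ξ(archAct (ι_𝔸 u) (a, b))` are `reindexPhase ε_v ⇑(toSp (archUForm v u))` of those of `Ξ(a, b)` — VERBATIM the
  totally-real dictionary `archFolland_archAct_adelicToSymplectic_slice` (`realSlice_archFolland_archAct_adelicToSymplectic`);
* §2 at a COMPLEX place `v` of `F` with chosen place `w(v)` of `E` over it, for an archimedean element `u = (g, 1)`:
  the complex `v`-slices of `Ξ(archAct (ι_𝔸 (g,1)) (a, b))` are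
  `cxRealify 1 (σ_{w(v)} T₀) (toSymplectic (archAtComplexSplit w(v) g))` of those of `Ξ(a, b)`
  (`cxSlice_archFolland_archAct_archToAdelic`; `ArchActQuadraticComplexPlaces` + `ArchFollandFrameTwist` +
  `ArchComplexPlaceRealification`);
* §3 the same two statements for the phase map `archPhaseMap … (ι_𝔸 …)` itself.

These are the slice inputs of the dictionary `hdict` of `AdelicMetaplecticArchSection.archLift` for a general number
field `F` (assembled with `MpS.tensorHom` in the sequel).  [GelbartRogawski1991, §3.1 p. 454; KonnoKonno2007, §3.1;
MoeglinVignerasWaldspurger1987, Chap. 1 I.17–I.19; Folland1989, Ch. 4 §1 Prop. (4.6)].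

## References
* [GelbartRogawski1991] S. Gelbart, J. Rogawski, Invent. math. 105 (1991), §3.1 p. 454.
* [KonnoKonno2007] K. Konno, T. Konno, Kyushu J. Math. 61 (2007), §3.1 (3.1).
* [MoeglinVignerasWaldspurger1987] C. Mœglin, M.-F. Vignéras, J.-L. Waldspurger, LNM 1291 (1987), Chap. 1 I.17–I.19.
* [Folland1989] G. B. Folland, *Harmonic Analysis in Phase Space*, Princeton UP 1989, Ch. 4 §1 Prop. (4.6), §1.3 (1.25).
-/

set_option autoImplicit false

open scoped Matrix Real Classical ComplexConjugate
open Complex NumberField NumberField.InfinitePlace NumberField.mixedEmbedding IsDedekindDomain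
open Literature.NumberTheory.Automorphic Literature.NumberTheory.Automorphic.UnitaryGroup
open Literature.RepresentationTheory.HeisenbergGroup Literature.Analysis.SegalBargmann
open Literature.RepresentationTheory.KonnoKonno2007 Literature.RepresentationTheory.KonnoKonno2007.RealDualPair

noncomputable section

namespace Literature.NumberTheory.Weil1964

local notation "PV" σ => (σ → ℝ) × (σ → ℝ)

/-! ## §0 The coordinate twist attached to a choice of places of `E` over the complex places of `F` -/

section Twist

variable (F : Type) [Field F] (E : Type) [Field E] [Algebra F E]
  (wOf : {v : InfinitePlace F // v.IsComplex} → {w : InfinitePlace E // w.IsComplex})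
  (hover : ∀ v, (wOf v).1.comap (algebraMap F E) = v.1)

/-- **`cxTwist wOf v = placeTwist v w(v)`** — the family of coordinate twists of a choice of places.
[cite: Folland1989, §1.3 (1.25)] -/
abbrev cxTwist : {v : InfinitePlace F // v.IsComplex} → (ℂ →+* ℂ) := fun v => placeTwist F E v ⟨(wOf v).1, hover v⟩

/-- each twist is continuous. [cite: Folland1989, §1.3 (1.25)] -/
theorem continuous_cxTwist : ∀ v, Continuous (cxTwist F E wOf hover v) := fun v => continuous_placeTwist F E v _

/-- the twisted embedding of `F` at `v` is `σ_{w(v)}|_F`. [cite: Folland1989, §1.3 (1.25)] -/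
theorem cxTwist_comp_embedding (v : {v : InfinitePlace F // v.IsComplex}) :
    (cxTwist F E wOf hover v).comp v.1.embedding = cxEmbOfPlace F E (wOf v) :=
  RingHom.ext fun t => placeTwist_embedding F E v ⟨(wOf v).1, hover v⟩ t

end Twist

/-! ## §1 The dictionary at a real place (general `F`) -/

section Real

variable {F : Type} [Field F] [NumberField F] (E : Type) [Field E] [NumberField E] [Algebra F E] (c : E ≃ₐ[F] E)
  (N : ℕ) (hc : c ≠ 1)
  (wOfR : {v : InfinitePlace F // v.IsReal} → {w : InfinitePlace E // w.IsComplex})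
  (hwR : ∀ v, c • (wOfR v).1 = (wOfR v).1) (hoverR : ∀ v, (wOfR v).1.comap (algebraMap F E) = v.1)
  (t₀ : Fin N → F) {J : Matrix (Fin N) (Fin N) E} (hJ : J = (Matrix.diagonal t₀).map (algebraMap F E))
  {P Q : {v : InfinitePlace F // v.IsReal} → Type*} [∀ v, Fintype (P v)] [∀ v, DecidableEq (P v)]
  [∀ v, Fintype (Q v)] [∀ v, DecidableEq (Q v)] (ε : ∀ v, Fin N ≃ P v ⊕ Q v)
  {D : {v : InfinitePlace F // v.IsReal} → Fin N → ℝ} (hD0 : ∀ v j, D v j ≠ 0)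
  {c' : {v : InfinitePlace F // v.IsReal} → ℝ} (hc' : ∀ v, c' v ≠ 0)
  (ht : ∀ v j, embedding_of_isReal v.2 (t₀ j) = c' v * signOf (ε v j) * D v j ^ 2)
  (ψ : {v : InfinitePlace F // v.IsComplex} → (ℂ →+* ℂ)) (hψ : ∀ v, Continuous (ψ v))
  (C : Fin N × {v : InfinitePlace F // v.IsComplex} → ℂ) (hC : ∀ k, C k ≠ 0)
  [Algebra.IsQuadraticExtension F E] {δ : E} (hcδ : c δ = -δ) (hδ : δ ≠ 0) {d : F}
  (hd : δ * δ = algebraMap F E d) (hT : (Matrix.diagonal t₀).IsSymm)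

/-- **The dictionary at one real place `v`, general `F`.**  For `u ∈ U(J)(𝔸_F)`, `J = diag(t₀) ⊗ 1`, the real
`v`-slices of `Ξ(archAct 𝕋 (ι_𝔸 u) (a, b))` in the twisted general frame are `reindexPhase ε_v ⇑(toSp (archUForm v u))`
applied to the real `v`-slices of `Ξ(a, b)`. [cite: GelbartRogawski1991, §3.1 p. 454; KonnoKonno2007, §3.1 (3.1);
Folland1989, Ch. 4 §1, Prop. (4.6) p. 151] -/
theorem realSlice_archFolland_archAct_adelicToSymplectic (hcc' : ∀ v, c' v = ((wOfR v).1.embedding δ).im)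
    (v : {v : InfinitePlace F // v.IsReal}) (u : UnitaryGroup.adelic F E c N J) (a b : Fin N → mixedSpace F) :
    (realSlice (Fin N) v (archFolland ((Matrix.diagonal t₀).map (algebraMap F (AdeleRing (𝓞 F) F)))
        (scaledFrameGenT F (Fin N) ψ hψ (placeScale N D) (placeScale_ne_zero N hD0) C hC)
        (archAct ((Matrix.diagonal t₀).map (algebraMap F (AdeleRing (𝓞 F) F)))
          (adelicToSymplectic F E c N hcδ hδ hd hT hJ u) (a, b))).1,
      realSlice (Fin N) v (archFolland ((Matrix.diagonal t₀).map (algebraMap F (AdeleRing (𝓞 F) F)))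
        (scaledFrameGenT F (Fin N) ψ hψ (placeScale N D) (placeScale_ne_zero N hD0) C hC)
        (archAct ((Matrix.diagonal t₀).map (algebraMap F (AdeleRing (𝓞 F) F)))
          (adelicToSymplectic F E c N hcδ hδ hd hT hJ u) (a, b))).2) =
      reindexPhase (ε v)
        (⇑((UForm.toSp (P v) (Q v) (archUForm E c N hc wOfR hwR hoverR t₀ hJ v (ε v) (hD0 v) (hc' v) (ht v) u)).1 :
          (PV (P v ⊕ Q v)) ≃ₗ[ℝ] PV (P v ⊕ Q v)))
        (realSlice (Fin N) v (archFolland ((Matrix.diagonal t₀).map (algebraMap F (AdeleRing (𝓞 F) F)))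
            (scaledFrameGenT F (Fin N) ψ hψ (placeScale N D) (placeScale_ne_zero N hD0) C hC) (a, b)).1,
          realSlice (Fin N) v (archFolland ((Matrix.diagonal t₀).map (algebraMap F (AdeleRing (𝓞 F) F)))
            (scaledFrameGenT F (Fin N) ψ hψ (placeScale N D) (placeScale_ne_zero N hD0) C hC) (a, b)).2) := by
  set T𝔸 := (Matrix.diagonal t₀).map (algebraMap F (AdeleRing (𝓞 F) F)) with hT𝔸
  set g := adelicToSymplectic F E c N hcδ hδ hd hT hJ u with hg
  rw [show archAct T𝔸 g (a, b) = ((archAct T𝔸 g (a, b)).1, (archAct T𝔸 g (a, b)).2) from rfl,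
    realSlice_archFolland_twist_diagonal, realSlice_archFolland_twist_diagonal]
  have hslice := placeVec_archAct_adelicToSymplectic F E c N hcδ hδ hc hd hT hJ v (wOfR v) (hwR v) (hoverR v) u a b
  rw [show (placeVec F (Fin N) v (archAct T𝔸 g (a, b)).1, placeVec F (Fin N) v (archAct T𝔸 g (a, b)).2) =
      (isQuadraticCoordinates_complex ((wOfR v).1.embedding δ)
          (UnitaryGroup.re_embedding_delta F E c (wOfR v) (hwR v) hc hcδ)
          (UnitaryGroup.im_embedding_delta_ne_zero F E c (wOfR v) (hwR v) hc hcδ hδ)).resEnd (Fin N)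
        (((archAt F E c N J (wOfR v) (hwR v) hc (archPart F E c N J u) : archLocal E N J (wOfR v)) : GL (Fin N) ℂ) :
          Matrix (Fin N) (Fin N) ℂ)
        (placeVec F (Fin N) v a, placeVec F (Fin N) v b) from hslice]
  rw [follandScale_resEnd_eq_reindexPhase_twRealify (isQuadraticCoordinates_complex ((wOfR v).1.embedding δ) _ _)
    (UnitaryGroup.re_embedding_delta F E c (wOfR v) (hwR v) hc hcδ) (ε v)
    (t := fun j => embedding_of_isReal v.2 (t₀ j)) (D := fun j => placeScale N D (j, v))
    (fun j => adapted_of_ht (E := E) (N := N) (wOf := wOfR) (t₀ := t₀) (ε := ε) (ht := ht) hcc' v j) (fun j => hD0 v j)]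
  congr 1
  rw [UForm.coe_toSp, coe_archUForm]

end Real

/-! ## §2 The dictionary at a complex place (archimedean elements) -/

section Complex

variable (F : Type) [Field F] [NumberField F] (E : Type) [Field E] [NumberField E] [Algebra F E]
  [Algebra.IsQuadraticExtension F E] (c : E ≃ₐ[F] E) (hcc : c * c = 1) (N : ℕ)
  {δ : E} (hcδ : c δ = -δ) (hδ : δ ≠ 0) {d : F} (hd : δ * δ = algebraMap F E d)
  (T₀ : Matrix (Fin N) (Fin N) F) (hT : T₀.IsSymm) (hTd : IsUnit T₀.det)
  {J : Matrix (Fin N) (Fin N) E} (hJ : J = T₀.map (algebraMap F E))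
  (wOf : {v : InfinitePlace F // v.IsComplex} → {w : InfinitePlace E // w.IsComplex})
  (hover : ∀ v, (wOf v).1.comap (algebraMap F E) = v.1)
  (D : Fin N × {v : InfinitePlace F // v.IsReal} → ℝ) (hD : ∀ k, D k ≠ 0)

include hcc in
/-- **The dictionary at one complex place `v`, archimedean elements.**  For `g ∈ U(J)(F ⊗ ℝ)`, `J = T₀ ⊗ 1`, the complex
`v`-slices of `Ξ(archAct 𝕋 (ι_𝔸 (g, 1)) (a, b))` in the twisted general frame (complex scalings `1`, twist
`placeTwist v w(v)`) are `cxRealify 1 (σ_{w(v)} T₀) (toSymplectic (archAtComplexSplit w(v) g))` applied to the complex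
`v`-slices of `Ξ(a, b)`. [cite: GelbartRogawski1991, §3.1 p. 454; MoeglinVignerasWaldspurger1987, Chap. 1 I.17;
Folland1989, Ch. 4 §1 Prop. (4.6)] -/
theorem cxSlice_archFolland_archAct_archToAdelic (v : {v : InfinitePlace F // v.IsComplex}) (g : UnitaryGroup.arch F E c N J)
    (a b : Fin N → mixedSpace F) :
    (cxSlice (Fin N) v (archFolland (T₀.map (algebraMap F (AdeleRing (𝓞 F) F)))
        (scaledFrameGenT F (Fin N) (cxTwist F E wOf hover) (continuous_cxTwist F E wOf hover) D hD
          (fun _ => (1 : ℂ)) (fun _ => one_ne_zero))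
        (archAct (T₀.map (algebraMap F (AdeleRing (𝓞 F) F)))
          (adelicToSymplectic F E c N hcδ hδ hd hT hJ (archToAdelic F E c N J g)) (a, b))).1,
      cxSlice (Fin N) v (archFolland (T₀.map (algebraMap F (AdeleRing (𝓞 F) F)))
        (scaledFrameGenT F (Fin N) (cxTwist F E wOf hover) (continuous_cxTwist F E wOf hover) D hD
          (fun _ => (1 : ℂ)) (fun _ => one_ne_zero))
        (archAct (T₀.map (algebraMap F (AdeleRing (𝓞 F) F)))
          (adelicToSymplectic F E c N hcδ hδ hd hT hJ (archToAdelic F E c N J g)) (a, b))).2) =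
      ((cxRealify (fun _ => (1 : ℂ)) one_scale_ne_zero (T₀.map (cxEmbOfPlace F E (wOf v)))
          (isUnit_det_map (cxEmbOfPlace F E (wOf v)) hTd)
          ((isQuadraticCoordinates_splitPair ((wOf v).1.embedding δ) (embedding_ne_zero E (wOf v) hδ)).toSymplectic (Fin N)
            (hT.map (cxEmbOfPlace F E (wOf v))) (swap_pair_diag (K := ℂ)) (swap_pair_delta ((wOf v).1.embedding δ)) rfl
            (archAtComplexSplit F E c N hcc (wOf v) T₀ hJ g)) :
            symplecticGroup (polar (dotPairing (Fin N ⊕ Fin N)))).1 :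
          (PV (Fin N ⊕ Fin N)) ≃ₗ[ℝ] PV (Fin N ⊕ Fin N))
        (cxSlice (Fin N) v (archFolland (T₀.map (algebraMap F (AdeleRing (𝓞 F) F)))
            (scaledFrameGenT F (Fin N) (cxTwist F E wOf hover) (continuous_cxTwist F E wOf hover) D hD
              (fun _ => (1 : ℂ)) (fun _ => one_ne_zero)) (a, b)).1,
          cxSlice (Fin N) v (archFolland (T₀.map (algebraMap F (AdeleRing (𝓞 F) F)))
            (scaledFrameGenT F (Fin N) (cxTwist F E wOf hover) (continuous_cxTwist F E wOf hover) D hD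
              (fun _ => (1 : ℂ)) (fun _ => one_ne_zero)) (a, b)).2) := by
  set T𝔸 := T₀.map (algebraMap F (AdeleRing (𝓞 F) F)) with hT𝔸
  set u := adelicToSymplectic F E c N hcδ hδ hd hT hJ (archToAdelic F E c N J g) with hu
  rw [show archAct T𝔸 u (a, b) = ((archAct T𝔸 u (a, b)).1, (archAct T𝔸 u (a, b)).2) from rfl,
    cxSlice_archFolland_twist, cxSlice_archFolland_twist]
  have hG : T₀.map ((cxTwist F E wOf hover v).comp v.1.embedding) = T₀.map (cxEmbOfPlace F E (wOf v)) := by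
    rw [cxTwist_comp_embedding]
  rw [hG]
  have hslice := placeVecC_archAct_archToAdelic F E c hcc N hcδ hδ hd hT hJ v (wOf v) (hover v) g a b
  rw [show ((fun j => cxTwist F E wOf hover v (placeVecC F (Fin N) v (archAct T𝔸 u (a, b)).1 j)),
        (fun j => cxTwist F E wOf hover v (placeVecC F (Fin N) v (archAct T𝔸 u (a, b)).2 j))) = _ from hslice]
  rw [cxRealify_apply_cxFollandScale]

end Complex

/-! ## §3 The same for the archimedean phase map -/

section PhaseMap

variable {F : Type} [Field F] [NumberField F] (E : Type) [Field E] [NumberField E] [Algebra F E] (c : E ≃ₐ[F] E)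
  (N : ℕ) (hc : c ≠ 1)
  (wOfR : {v : InfinitePlace F // v.IsReal} → {w : InfinitePlace E // w.IsComplex})
  (hwR : ∀ v, c • (wOfR v).1 = (wOfR v).1) (hoverR : ∀ v, (wOfR v).1.comap (algebraMap F E) = v.1)
  (t₀ : Fin N → F) {J : Matrix (Fin N) (Fin N) E} (hJ : J = (Matrix.diagonal t₀).map (algebraMap F E))
  {P Q : {v : InfinitePlace F // v.IsReal} → Type*} [∀ v, Fintype (P v)] [∀ v, DecidableEq (P v)]
  [∀ v, Fintype (Q v)] [∀ v, DecidableEq (Q v)] (ε : ∀ v, Fin N ≃ P v ⊕ Q v)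
  {D : {v : InfinitePlace F // v.IsReal} → Fin N → ℝ} (hD0 : ∀ v j, D v j ≠ 0)
  {c' : {v : InfinitePlace F // v.IsReal} → ℝ} (hc' : ∀ v, c' v ≠ 0)
  (ht : ∀ v j, embedding_of_isReal v.2 (t₀ j) = c' v * signOf (ε v j) * D v j ^ 2)
  (ψ : {v : InfinitePlace F // v.IsComplex} → (ℂ →+* ℂ)) (hψ : ∀ v, Continuous (ψ v))
  (C : Fin N × {v : InfinitePlace F // v.IsComplex} → ℂ) (hC : ∀ k, C k ≠ 0)
  [Algebra.IsQuadraticExtension F E] {δ : E} (hcδ : c δ = -δ) (hδ : δ ≠ 0) {d : F}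
  (hd : δ * δ = algebraMap F E d) (hT : (Matrix.diagonal t₀).IsSymm)

/-- **the real slices of the archimedean phase map of `ι_𝔸 u`** in the twisted general frame.
[cite: GelbartRogawski1991, §3.1 p. 454; KonnoKonno2007, §3.1 (3.1)] -/
theorem realSlice_archPhaseMap_adelicToSymplectic (hcc' : ∀ v, c' v = ((wOfR v).1.embedding δ).im)
    (hTu : IsUnit (archMat F (Fin N) ((Matrix.diagonal t₀).map (algebraMap F (AdeleRing (𝓞 F) F)))))
    (v : {v : InfinitePlace F // v.IsReal}) (u : UnitaryGroup.adelic F E c N J) (pq : PV (FrameIdx F (Fin N))) :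
    (realSlice (Fin N) v (archPhaseMap ((Matrix.diagonal t₀).map (algebraMap F (AdeleRing (𝓞 F) F)))
        (scaledFrameGenT F (Fin N) ψ hψ (placeScale N D) (placeScale_ne_zero N hD0) C hC) hTu
        (adelicToSymplectic F E c N hcδ hδ hd hT hJ u) pq).1,
      realSlice (Fin N) v (archPhaseMap ((Matrix.diagonal t₀).map (algebraMap F (AdeleRing (𝓞 F) F)))
        (scaledFrameGenT F (Fin N) ψ hψ (placeScale N D) (placeScale_ne_zero N hD0) C hC) hTu
        (adelicToSymplectic F E c N hcδ hδ hd hT hJ u) pq).2) =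
      reindexPhase (ε v)
        (⇑((UForm.toSp (P v) (Q v) (archUForm E c N hc wOfR hwR hoverR t₀ hJ v (ε v) (hD0 v) (hc' v) (ht v) u)).1 :
          (PV (P v ⊕ Q v)) ≃ₗ[ℝ] PV (P v ⊕ Q v)))
        (realSlice (Fin N) v pq.1, realSlice (Fin N) v pq.2) := by
  obtain ⟨⟨a, b⟩, rfl⟩ := (archFolland_bijective (T := (Matrix.diagonal t₀).map (algebraMap F (AdeleRing (𝓞 F) F)))
    (scaledFrameGenT F (Fin N) ψ hψ (placeScale N D) (placeScale_ne_zero N hD0) C hC) hTu).2 pq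
  rw [archPhaseMap_archFolland]
  exact realSlice_archFolland_archAct_adelicToSymplectic E c N hc wOfR hwR hoverR t₀ hJ ε hD0 hc' ht ψ hψ C hC hcδ hδ hd hT
    hcc' v u a b

end PhaseMap

section PhaseMapComplex

variable (F : Type) [Field F] [NumberField F] (E : Type) [Field E] [NumberField E] [Algebra F E]
  [Algebra.IsQuadraticExtension F E] (c : E ≃ₐ[F] E) (hcc : c * c = 1) (N : ℕ)
  {δ : E} (hcδ : c δ = -δ) (hδ : δ ≠ 0) {d : F} (hd : δ * δ = algebraMap F E d)
  (T₀ : Matrix (Fin N) (Fin N) F) (hT : T₀.IsSymm) (hTd : IsUnit T₀.det)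
  {J : Matrix (Fin N) (Fin N) E} (hJ : J = T₀.map (algebraMap F E))
  (wOf : {v : InfinitePlace F // v.IsComplex} → {w : InfinitePlace E // w.IsComplex})
  (hover : ∀ v, (wOf v).1.comap (algebraMap F E) = v.1)
  (D : Fin N × {v : InfinitePlace F // v.IsReal} → ℝ) (hD : ∀ k, D k ≠ 0)

include hcc in
/-- **the complex slices of the archimedean phase map of `ι_𝔸 (g, 1)`** in the twisted general frame.
[cite: GelbartRogawski1991, §3.1 p. 454; MoeglinVignerasWaldspurger1987, Chap. 1 I.17] -/
theorem cxSlice_archPhaseMap_archToAdelic (hTu : IsUnit (archMat F (Fin N) (T₀.map (algebraMap F (AdeleRing (𝓞 F) F)))))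
    (v : {v : InfinitePlace F // v.IsComplex}) (g : UnitaryGroup.arch F E c N J) (pq : PV (FrameIdx F (Fin N))) :
    (cxSlice (Fin N) v (archPhaseMap (T₀.map (algebraMap F (AdeleRing (𝓞 F) F)))
        (scaledFrameGenT F (Fin N) (cxTwist F E wOf hover) (continuous_cxTwist F E wOf hover) D hD
          (fun _ => (1 : ℂ)) (fun _ => one_ne_zero)) hTu
        (adelicToSymplectic F E c N hcδ hδ hd hT hJ (archToAdelic F E c N J g)) pq).1,
      cxSlice (Fin N) v (archPhaseMap (T₀.map (algebraMap F (AdeleRing (𝓞 F) F)))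
        (scaledFrameGenT F (Fin N) (cxTwist F E wOf hover) (continuous_cxTwist F E wOf hover) D hD
          (fun _ => (1 : ℂ)) (fun _ => one_ne_zero)) hTu
        (adelicToSymplectic F E c N hcδ hδ hd hT hJ (archToAdelic F E c N J g)) pq).2) =
      ((cxRealify (fun _ => (1 : ℂ)) one_scale_ne_zero (T₀.map (cxEmbOfPlace F E (wOf v)))
          (isUnit_det_map (cxEmbOfPlace F E (wOf v)) hTd)
          ((isQuadraticCoordinates_splitPair ((wOf v).1.embedding δ) (embedding_ne_zero E (wOf v) hδ)).toSymplectic (Fin N)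
            (hT.map (cxEmbOfPlace F E (wOf v))) (swap_pair_diag (K := ℂ)) (swap_pair_delta ((wOf v).1.embedding δ)) rfl
            (archAtComplexSplit F E c N hcc (wOf v) T₀ hJ g)) :
            symplecticGroup (polar (dotPairing (Fin N ⊕ Fin N)))).1 :
          (PV (Fin N ⊕ Fin N)) ≃ₗ[ℝ] PV (Fin N ⊕ Fin N))
        (cxSlice (Fin N) v pq.1, cxSlice (Fin N) v pq.2) := by
  obtain ⟨⟨a, b⟩, rfl⟩ := (archFolland_bijective (T := T₀.map (algebraMap F (AdeleRing (𝓞 F) F)))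
    (scaledFrameGenT F (Fin N) (cxTwist F E wOf hover) (continuous_cxTwist F E wOf hover) D hD
      (fun _ => (1 : ℂ)) (fun _ => one_ne_zero)) hTu).2 pq
  rw [archPhaseMap_archFolland]
  exact cxSlice_archFolland_archAct_archToAdelic F E c hcc N hcδ hδ hd T₀ hT hTd hJ wOf hover D hD v g a b

end PhaseMapComplex

end Literature.NumberTheory.Weil1964

end
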